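import Summits.BirchSwinnertonDyer.BirchSwinnertonDyer.Theorems.ThetaPartnerAtTwoSignedKatoUpToAtTwoKatoBKBricks
import HarnessLib

/-!
# Crux `SupersingularRankZeroAtTwo` (K4, item stmt-BirchSwinnertonDyer-19097), line `odd_blind_package` v2.19, `stub_flatPackage`
# conjunct (8), F3 — FILE E2c: the TRIVIAL-CHARACTER BRICKS for a GENERAL `a₂` (base levels `n ≤ 1` of the ♭ level identity):
# Hecke at `2` (`RTSS f 𝟙 = (a₂²−2a₂−1)[0]⁺`, `(a₂³−2a₂²−3a₂+4)[0]⁺`) and Kato's depleted value (`P₂(2⁻¹) = (3 − a₂)/2`)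

Seat `bsd-2adic-tower-1` GEN 69, hand «hF3-ERL» (pen GEN 41 SUMMON 20260831T215831Z, director-bsd (979) slot 2). HONEST FRAMING: theorems
only (no definition, no named fact, no instance, no `sorry`); the `a₂`-generic twins of K3's bricks B4a/B4c (`KatoBK.heckeBaseTwo_brick`,
`KatoBK.katoTrivialValuesTwo_brick`, which are `a₂ = 0`), both ONE-LINE consequences of tree theorems that are already `a₂`-generic
(`HeckeBase.ratTwistedSymbolSum_one_level_two_eq/_three_eq`, `KatoValue.sum_sigma_eq_of_zetaBody`); helper toward conjunct (8) F3 of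
`stub_flatPackage` (they are the inputs `hH`, `hB4c` of `SSFlatERL.flat_level_identity_trivial`, `h₀ = a₂²−2a₂−1` resp. `a₂³−2a₂²−3a₂+4`,
`u = 3 − a₂`); closes no stub and no item; 19097 OPEN; BSD₂ is proved for no supersingular curve and BSD for no curve by any of this.

References: [MazurTateTeitelbaum1986Invent] §I.4 (4.2), §I.8 (8.6); [Kato2004Asterisque] Thm. 6.6 (1) (p. 163), Thm. 9.7 (p. 189), §6.2 (p. 161),
Ex. 13.3 (p. 225); [Sprung2012] Thm. 2.2.
-/

set_option autoImplicit false
-- the Theorems namespace of this sub repeats the summit name by design (D-0017 nested layout)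
set_option linter.dupNamespace false

noncomputable section

set_option backward.isDefEq.respectTransparency false

open scoped Classical MatrixGroups ModularForm NumberField TensorProduct

open CongruenceSubgroup WeierstrassCurve Field IsDedekindDomain NumberField
  Literature.NumberTheory.GaloisRepresentations
  Literature.NumberTheory.EllipticCurves Literature.NumberTheory.EllipticCurves.ModularForms
  Literature.NumberTheory.EllipticCurves.Module Literature.NumberTheory.EllipticCurves.Rank1Residual
  Literature.NumberTheory.EllipticCurves.Kobayashi2003 Literature.NumberTheory.EllipticCurves.Kato2004
  Literature.NumberTheory.EllipticCurves.Kato2004.EulerSystemValues Literature.NumberTheory.EllipticCurves.GreenbergSelmer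
  Literature.NumberTheory.EllipticCurves.Sprung2012
  Literature.NumberTheory.EllipticCurves.FormalGroupChart
  ZpExtension Summit.BirchSwinnertonDyer.Rank1Residual.Supersingular
  Summit.BirchSwinnertonDyer.Rank1Residual.Additive Summit.BirchSwinnertonDyer.Rank1Residual.Additive.PadicCyclotomicTower
  Summit.BirchSwinnertonDyer.Rank1Residual.Additive.BallEval
  Summit.BirchSwinnertonDyer.BirchSwinnertonDyer.Theorems.SignedKatoOffTwo.LocalTwo

namespace Summit.BirchSwinnertonDyer.BirchSwinnertonDyer.Theorems.SSFlatERL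

open Summit.BirchSwinnertonDyer.BirchSwinnertonDyer.Theorems.SignedKatoOffTwo
  Summit.BirchSwinnertonDyer.BirchSwinnertonDyer.Theorems.SignedKatoOffTwo.KatoBK

/-- **Hecke at `2` for the trivial character, general `a₂`** (levels `2^{0+2}` and `2^{1+2}`, socket shape of K3 brick B4a):
`RTSS f 𝟙 = (a² − 2a − 1)·[0]⁺_f` at level `4` and `(a³ − 2a² − 3a + 4)·[0]⁺_f` at level `8` — `HeckeBase.ratTwistedSymbolSum_one_level_two_eq` /
`…_three_eq`. (`KatoBK.heckeBaseTwo_brick` is `a = 0`: `−[0]⁺`, `4[0]⁺`.) [cite: MazurTateTeitelbaum1986Invent, §I.4 (4.2)] -/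
theorem heckeBaseTwo_brick_of_cuspCoeff {N : ℕ} [NeZero N] (f : CuspForm (Gamma0 N) 2) (hf : IsNewform0 f) (hQ : coeffField f = ⊥)
    (h2N : ¬ 2 ∣ N) {a : ℤ} (ha : cuspCoeff f 2 = a) :
    ratTwistedSymbolSum f (1 : DirichletCharacter ℂ_[2] (2 ^ (0 + 2))) = ((((a : ℚ) ^ 2 - 2 * a - 1) * ratPlusSymbol f 0 : ℚ) : ℂ_[2]) ∧
    ratTwistedSymbolSum f (1 : DirichletCharacter ℂ_[2] (2 ^ (1 + 2))) =
      ((((a : ℚ) ^ 3 - 2 * a ^ 2 - 3 * a + 4) * ratPlusSymbol f 0 : ℚ) : ℂ_[2]) :=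
  ⟨HeckeBase.ratTwistedSymbolSum_one_level_two_eq ℂ_[2] hf hQ h2N ha (0 + 2) rfl,
    HeckeBase.ratTwistedSymbolSum_one_level_three_eq ℂ_[2] hf hQ h2N ha (1 + 2) rfl⟩

/-- **`P₂(2⁻¹) = (3 − a₂)/2`**: for `2 ∤ N` and `W.LFunction 2 = a₂`, `eulerFactorAtOne W N 2 = 1 − a₂/2 + 1/2 = (3 − a₂)/2` (the order of
`Ẽ(𝔽₂)` over `2`; `KatoValue.eulerFactorAtOne_two_eq` is `a₂ = 0`). [cite: Kato2004Asterisque, §6.2 (p. 161), Ex. 13.3 (p. 225)] -/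
theorem eulerFactorAtOne_two_eq_of_lFunction (W : WeierstrassCurve ℚ) {N : ℕ} {a₂ : ℤ} (ha : W.LFunction 2 = a₂) (hN : ¬ 2 ∣ N) :
    eulerFactorAtOne W N 2 = (3 - (a₂ : ℚ)) / 2 := by
  rw [eulerFactorAtOne, ha, if_neg hN]
  push_cast
  ring

/-- **Kato's trivial-character values at levels `4, 8` for a GENERAL `a₂`** (K3 brick B4c `KatoBK.katoTrivialValuesTwo_brick` with the
`{2}`-depletion factor `eulerFactorAtOne W N 2 = (3 − a₂)/2 = u/2` in place of `3/2`; `KatoValue.sum_sigma_eq_of_zetaBody`). This is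
`SSFlatERL.flat_level_identity_trivial`'s `hB4c` with `u = 3 − a₂`. [cite: Kato2004Asterisque, Thm. 6.6 (1), Thm. 9.7, §6.2] -/
theorem katoTrivialValuesTwo_brick_of_frobeniusTrace {a₂ : ℤ} :
    ∀ (W : WeierstrassCurve ℚ) [W.IsElliptic] [W.IsGloballyMinimal], GoodSS W 2 → W.frobeniusTrace 2 = a₂ →
    ∀ [NeZero (W.conductorNorm ℤ)] (f : CuspForm (Gamma0 (W.conductorNorm ℤ)) 2), IsNewformOf W f →
    ∀ [ContinuousSMul ℤ_[2] (W.tateModule 2)] [Module.Free ℤ_[2] (W.tateModule 2)] [Module.Finite ℤ_[2] (W.tateModule 2)]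
    {ιC : (m : ℕ) → (CyclotomicField m ℚ →+* ℂ)} {κK : ℝ}
    {ΛK : ∀ (k : ℕ) (r : Finset (HeightOneSpectrum (𝓞 ℚ))),
      H1 (tateRep W 2) (cycSubgroup 2 k r) →ₗ[ℤ_[2]] ℚ_[2] ⊗[ℚ] CyclotomicField (cycLevel 2 k r) ℚ}
    {c d a : ℤ} {A : ℕ}
    {z : ∀ (k : ℕ) (r : (cyclotomicLevelsRat 2 (badPlaces c d A (W.conductorNorm ℤ))).Ideals),
      H1 (tateRep W 2) ((cyclotomicLevelsRat 2 (badPlaces c d A (W.conductorNorm ℤ))).level k r.1)}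
    {x : ∀ (k : ℕ) (r : (cyclotomicLevelsRat 2 (badPlaces c d A (W.conductorNorm ℤ))).Ideals),
      CyclotomicField (cycLevel 2 k r.1) ℚ},
    ZetaBody W 2 f ιC κK ΛK c d a A z x → ∀ {q : ℚ}, κK = q → ∀ {ee : ℕ}, A = 2 ^ ee → ∀ (d' : ℤ), d * d' ≡ 1 [ZMOD (A : ℤ)] →
    ∀ (k : ℕ), 2 ≤ k → k ≤ 3 → Int.gcd (c * d) (cycLevel 2 k (∅ : Finset (HeightOneSpectrum (𝓞 ℚ))) * A) = 1 →
    ∑ b : (ZMod (cycLevel 2 k (∅ : Finset (HeightOneSpectrum (𝓞 ℚ)))))ˣ,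
        sigma (cycLevel 2 k (∅ : Finset (HeightOneSpectrum (𝓞 ℚ)))) b
          (x k (cyclotomicLevelsRat 2 (badPlaces c d A (W.conductorNorm ℤ))).idealOne) =
      (((3 - (a₂ : ℚ)) / 2 * q * ratPlusSymbol f 0 *
          (c ^ 2 * d ^ 2 * ratMinusSymbol f ((a : ℚ) / A) - c * d ^ 2 * ratMinusSymbol f ((a * c : ℚ) / A)
            - c ^ 2 * d * ratMinusSymbol f ((a * d' : ℚ) / A) + c * d * ratMinusSymbol f ((a * c * d' : ℚ) / A)) : ℚ) :
        CyclotomicField (cycLevel 2 k (∅ : Finset (HeightOneSpectrum (𝓞 ℚ)))) ℚ) := by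
  intro W _ _ hss ha _ f hf _ _ _ ιC κK ΛK c d a A z x hbody q hq ee hA d' hdd' k hk2 hk3 hcd
  have hN2 : ¬ 2 ∣ W.conductorNorm ℤ := not_dvd_level_of_isNewformOf hf hss.1
  have hL2 : W.LFunction 2 = a₂ := by rw [LFunction_apply_prime_eq_frobeniusTrace W 2 hss.1, ha]
  have h := KatoValue.sum_sigma_eq_of_zetaBody hf 2 hbody hq (by omega : 1 ≤ k) hA d' hcd hdd'
  rw [h, eulerFactorAtOne_two_eq_of_lFunction W hL2 hN2, eq_ratCast, ratCuspFactor]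
  congr 1
  simp only [↓reduceIte, hA]
  push_cast
  ring


end Summit.BirchSwinnertonDyer.BirchSwinnertonDyer.Theorems.SSFlatERL

end
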